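import Literature.NumberTheory.Automorphic.UnitaryGroupCongruenceSubgroupLevels
import HarnessLib

/-!
# Arithmetic level PAIRS `(Γ(K), K)` under rational conjugation and deepening

Registry: pub-hodgecm MODEL-CONSTRUCTION sub-cell, BINDER-TRIAGE §57 (Θ-sat-K)/(W1) (carver ruling
2026-08-19): the model's level becomes PerL's PAIR `(Γ, K)` — a compact open `K ≤ U(J)(𝔸_{F,f})` together with
its arithmetic level `Γ = Γ(K) = U(J)(F) ∩ K` (tree `UnitaryGroup.arithmeticLevel`) — because the existence lift
`UnitaryGroup.levelOf` (a `Classical.choose` of an exponent) admits no monotonicity / conjugation statements.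
This leaf supplies the two elementary CONSTRUCTIONS OF PAIRS every level-changing argument needs
(H-stability under rational translates, level deepening), in the tree's own currency:

* generic topological-group facts: the conjugate `b K b⁻¹` of an open (compact) subgroup is open (compact)
  (`Subgroup.isOpen_map_conj`, `Subgroup.isCompact_map_conj`); an open subgroup of a compact one is compact
  (`Subgroup.isCompact_inf_of_isOpen`);
* **`arithmeticLevel_map_conj`**: for `γ ∈ U(J)(F)`, `Γ(γ_f K γ_f⁻¹) = γ Γ(K) γ⁻¹`
  (membership form `mem_arithmeticLevel_map_conj_iff`: `g ∈ Γ(γ_f K γ_f⁻¹) ↔ γ⁻¹ g γ ∈ Γ(K)`);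
* **`conjPair`** = the pair `K' := K ∩ γ_f⁻¹ K γ_f`: compact open when `K` is, with
  `Γ(K') = Γ(K) ∩ γ⁻¹ Γ(K) γ`, `γ_f K' γ_f⁻¹ ≤ K` and `γ Γ(K') γ⁻¹ ≤ Γ(K)`
  (`isCompact_conjPair`, `isOpen_conjPair`, `arithmeticLevel_conjPair`, `conj_mem_of_mem_conjPair`,
  `conj_mem_arithmeticLevel_of_mem_conjPair`) — the finite-adelic AND archimedean halves of the translate
  hypothesis at once (cf. PKG `Model/HLevDischarge.exists_level_conj_le`, archimedean half only);
* **`deepenPair`** = the pair `K ∩ K_{U,f}(n𝓞_E)`: compact open for `n ≠ 0`, `Γ = Γ(K) ∩ Γ(n)`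
  (`arithmeticLevel_deepenPair`), torsion-free for `3 ≤ n` (`torsionFree_arithmeticLevel_deepenPair`);
  both pairs give congruence subgroups (`isCongruenceSubgroup_arithmeticLevel_conjPair/_deepenPair`, via the
  tree's `isCongruenceSubgroup_arithmeticLevel_of_isOpen`).

All statements are folklore (Platonov–Rapinchuk 1994 §4.1: arithmetic subgroups are stable under
`G(F)`-conjugation up to commensurability; here the exact identity for levels). No hypotheses beyond the data.
-/

namespace Subgroup

variable {B : Type} [Group B]

/-- Membership in a conjugate subgroup: `x ∈ b K b⁻¹ ↔ b⁻¹ x b ∈ K`. [folklore] -/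
theorem mem_map_conj_iff (K : Subgroup B) (b x : B) :
    x ∈ K.map (MulAut.conj b).toMonoidHom ↔ b⁻¹ * x * b ∈ K := by
  constructor
  · rintro ⟨y, hy, rfl⟩
    simpa [MulAut.conj_apply, mul_assoc] using hy
  · intro h
    exact ⟨b⁻¹ * x * b, h, by simp [MulAut.conj_apply, mul_assoc]⟩

/-- As a set, `b K b⁻¹` is the preimage of `K` under `x ↦ b⁻¹ x b`. [folklore] -/
theorem coe_map_conj_eq_preimage (K : Subgroup B) (b : B) :
    ((K.map (MulAut.conj b).toMonoidHom : Subgroup B) : Set B) = (fun x => b⁻¹ * x * b) ⁻¹' (K : Set B) := by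
  ext x
  exact mem_map_conj_iff K b x

/-- As a set, `b K b⁻¹` is the image of `K` under `x ↦ b x b⁻¹`. [folklore] -/
theorem coe_map_conj_eq_image (K : Subgroup B) (b : B) :
    ((K.map (MulAut.conj b).toMonoidHom : Subgroup B) : Set B) = (fun x => b * x * b⁻¹) '' (K : Set B) := by
  ext x
  simp only [SetLike.mem_coe, Subgroup.mem_map, MulEquiv.coe_toMonoidHom, MulAut.conj_apply, Set.mem_image]

section Topology

variable [TopologicalSpace B] [IsTopologicalGroup B]

/-- The conjugate of an open subgroup is open. [folklore] -/
theorem isOpen_map_conj {K : Subgroup B} (hK : IsOpen (K : Set B)) (b : B) :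
    IsOpen ((K.map (MulAut.conj b).toMonoidHom : Subgroup B) : Set B) := by
  rw [coe_map_conj_eq_preimage]
  exact hK.preimage (by fun_prop)

/-- The conjugate of a compact subgroup is compact. [folklore] -/
theorem isCompact_map_conj {K : Subgroup B} (hK : IsCompact (K : Set B)) (b : B) :
    IsCompact ((K.map (MulAut.conj b).toMonoidHom : Subgroup B) : Set B) := by
  rw [coe_map_conj_eq_image]
  exact hK.image (by fun_prop)

/-- An open subgroup of a compact subgroup is compact: `K ∩ K'` for `K` compact and `K, K'` open
(open subgroups are closed). [folklore] -/
theorem isCompact_inf_of_isOpen {K K' : Subgroup B} (hKc : IsCompact (K : Set B)) (hK : IsOpen (K : Set B))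
    (hK' : IsOpen (K' : Set B)) : IsCompact ((K ⊓ K' : Subgroup B) : Set B) :=
  hKc.of_isClosed_subset ((K ⊓ K').isClosed_of_isOpen (by rw [Subgroup.coe_inf]; exact hK.inter hK'))
    (SetLike.coe_subset_coe.2 inf_le_left)

end Topology

end Subgroup

open scoped NumberField

namespace Literature.NumberTheory.Automorphic

namespace UnitaryGroup

variable {F E : Type} [Field F] [NumberField F] [Field E] [NumberField E] [Algebra F E]
  {c : E ≃ₐ[F] E} {N : ℕ} {J : Matrix (Fin N) (Fin N) E}

/-! ## 1. `Γ(γ_f K γ_f⁻¹) = γ Γ(K) γ⁻¹` -/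

omit [NumberField F] in
/-- **Rational conjugation of an arithmetic level (membership form)**: for `γ ∈ U(J)(F)`,
`g ∈ Γ(γ_f K γ_f⁻¹) ↔ γ⁻¹ g γ ∈ Γ(K)`. [folklore] -/
theorem mem_arithmeticLevel_map_conj_iff (K : Subgroup (finAdelic F E c N J)) (γ : rational F E c N J)
    {g : GL (Fin N) E} :
    g ∈ arithmeticLevel F E c N J (K.map (MulAut.conj (rationalToFinAdelic F E c N J γ)).toMonoidHom) ↔
      (γ : GL (Fin N) E)⁻¹ * g * γ ∈ arithmeticLevel F E c N J K := by
  rw [mem_arithmeticLevel_iff, mem_arithmeticLevel_iff]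
  constructor
  · rintro ⟨hg, hk⟩
    have hg' : (γ : GL (Fin N) E)⁻¹ * g * γ ∈ rational F E c N J :=
      mul_mem (mul_mem (inv_mem γ.2) hg) γ.2
    refine ⟨hg', ?_⟩
    have h := (Subgroup.mem_map_conj_iff K _ _).1 hk
    have e : (⟨(γ : GL (Fin N) E)⁻¹ * g * γ, hg'⟩ : rational F E c N J) = γ⁻¹ * ⟨g, hg⟩ * γ := rfl
    rwa [e, map_mul, map_mul, map_inv]
  · rintro ⟨hg', hk⟩
    have hg : g ∈ rational F E c N J := by
      have := mul_mem (mul_mem γ.2 hg') (inv_mem γ.2)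
      simpa [mul_assoc] using this
    refine ⟨hg, (Subgroup.mem_map_conj_iff K _ _).2 ?_⟩
    have e : (⟨(γ : GL (Fin N) E)⁻¹ * g * γ, hg'⟩ : rational F E c N J) = γ⁻¹ * ⟨g, hg⟩ * γ := rfl
    rwa [e, map_mul, map_mul, map_inv] at hk

omit [NumberField F] in
/-- **`Γ(γ_f K γ_f⁻¹) = γ Γ(K) γ⁻¹`** for `γ ∈ U(J)(F)`. Platonov–Rapinchuk 1994, §4.1. [folklore] -/
theorem arithmeticLevel_map_conj (K : Subgroup (finAdelic F E c N J)) (γ : rational F E c N J) :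
    arithmeticLevel F E c N J (K.map (MulAut.conj (rationalToFinAdelic F E c N J γ)).toMonoidHom) =
      (arithmeticLevel F E c N J K).map (MulAut.conj (γ : GL (Fin N) E)).toMonoidHom := by
  ext g
  rw [mem_arithmeticLevel_map_conj_iff, Subgroup.mem_map_conj_iff]

/-! ## 2. The conjugation pair `K' = K ∩ γ_f⁻¹ K γ_f` -/

variable (F E c N J) in
/-- **The conjugation pair level** `K' := K ∩ γ_f⁻¹ K γ_f` of a level `K` and a rational `γ`. [folklore] -/
noncomputable def conjPair (K : Subgroup (finAdelic F E c N J)) (γ : rational F E c N J) : Subgroup (finAdelic F E c N J) :=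
  K ⊓ K.map (MulAut.conj (rationalToFinAdelic F E c N J γ⁻¹)).toMonoidHom

omit [NumberField F] in
/-- `K' ≤ K`. [folklore] -/
theorem conjPair_le (K : Subgroup (finAdelic F E c N J)) (γ : rational F E c N J) :
    conjPair F E c N J K γ ≤ K := inf_le_left

omit [NumberField F] in
/-- `K'` is open when `K` is. [folklore] -/
theorem isOpen_conjPair {K : Subgroup (finAdelic F E c N J)} (hK : IsOpen (K : Set (finAdelic F E c N J)))
    (γ : rational F E c N J) : IsOpen (conjPair F E c N J K γ : Set (finAdelic F E c N J)) := by
  rw [conjPair, Subgroup.coe_inf]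
  exact hK.inter (Subgroup.isOpen_map_conj hK _)

omit [NumberField F] in
/-- `K'` is compact when `K` is compact open. [folklore] -/
theorem isCompact_conjPair {K : Subgroup (finAdelic F E c N J)} (hKc : IsCompact (K : Set (finAdelic F E c N J)))
    (hK : IsOpen (K : Set (finAdelic F E c N J))) (γ : rational F E c N J) :
    IsCompact (conjPair F E c N J K γ : Set (finAdelic F E c N J)) :=
  Subgroup.isCompact_inf_of_isOpen hKc hK (Subgroup.isOpen_map_conj hK _)

omit [NumberField F] in
/-- **`Γ(K') = Γ(K) ∩ γ⁻¹ Γ(K) γ`.** [folklore] -/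
theorem arithmeticLevel_conjPair (K : Subgroup (finAdelic F E c N J)) (γ : rational F E c N J) :
    arithmeticLevel F E c N J (conjPair F E c N J K γ) =
      arithmeticLevel F E c N J K ⊓
        (arithmeticLevel F E c N J K).map (MulAut.conj ((γ : GL (Fin N) E)⁻¹)).toMonoidHom := by
  rw [conjPair, arithmeticLevel_inf, arithmeticLevel_map_conj]
  rfl

omit [NumberField F] in
/-- **Finite-adelic half**: `γ_f K' γ_f⁻¹ ≤ K`, i.e. `γ_f k γ_f⁻¹ ∈ K` for `k ∈ K'`. [folklore] -/
theorem conj_mem_of_mem_conjPair {K : Subgroup (finAdelic F E c N J)} {γ : rational F E c N J}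
    {k : finAdelic F E c N J} (hk : k ∈ conjPair F E c N J K γ) :
    rationalToFinAdelic F E c N J γ * k * (rationalToFinAdelic F E c N J γ)⁻¹ ∈ K := by
  have h := (Subgroup.mem_map_conj_iff K _ _).1 hk.2
  rwa [map_inv, inv_inv] at h

omit [NumberField F] in
/-- **Archimedean (rational) half**: `γ Γ(K') γ⁻¹ ≤ Γ(K)`, i.e. `γ δ γ⁻¹ ∈ Γ(K)` for `δ ∈ Γ(K')`. [folklore] -/
theorem conj_mem_arithmeticLevel_of_mem_conjPair {K : Subgroup (finAdelic F E c N J)} {γ : rational F E c N J}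
    {δ : GL (Fin N) E} (hδ : δ ∈ arithmeticLevel F E c N J (conjPair F E c N J K γ)) :
    (γ : GL (Fin N) E) * δ * (γ : GL (Fin N) E)⁻¹ ∈ arithmeticLevel F E c N J K := by
  rw [arithmeticLevel_conjPair] at hδ
  have h := (Subgroup.mem_map_conj_iff _ _ _).1 hδ.2
  simpa using h

omit [NumberField F] in
/-- `Γ(K') ≤ Γ(K)`. [folklore] -/
theorem arithmeticLevel_conjPair_le (K : Subgroup (finAdelic F E c N J)) (γ : rational F E c N J) :
    arithmeticLevel F E c N J (conjPair F E c N J K γ) ≤ arithmeticLevel F E c N J K :=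
  arithmeticLevel_mono (conjPair_le K γ)

omit [NumberField F] in
/-- `Γ(K')` is a congruence subgroup when `K` is compact open. [folklore] -/
theorem isCongruenceSubgroup_arithmeticLevel_conjPair {K : Subgroup (finAdelic F E c N J)}
    (hKc : IsCompact (K : Set (finAdelic F E c N J))) (hK : IsOpen (K : Set (finAdelic F E c N J)))
    (γ : rational F E c N J) :
    Literature.AlgebraicGeometry.ShimuraVarieties.IsCongruenceSubgroup (c : E →+* E) J
      (arithmeticLevel F E c N J (conjPair F E c N J K γ)) :=
  isCongruenceSubgroup_arithmeticLevel_of_isOpen (isCompact_conjPair hKc hK γ) (isOpen_conjPair hK γ)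

/-! ## 3. The deepening pair `K ∩ K_{U,f}(n𝓞_E)` -/

variable (F E c N J) in
/-- **The deepening pair level** `K ∩ K_{U,f}(n𝓞_E)` (intersection with a principal level). [folklore] -/
noncomputable def deepenPair (K : Subgroup (finAdelic F E c N J)) (n : ℕ) : Subgroup (finAdelic F E c N J) :=
  K ⊓ finCongruenceLevel F E c N J (Ideal.span {(n : 𝓞 E)})

omit [NumberField F] in
/-- `K ∩ K_{U,f}(n) ≤ K`. [folklore] -/
theorem deepenPair_le (K : Subgroup (finAdelic F E c N J)) (n : ℕ) : deepenPair F E c N J K n ≤ K :=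
  inf_le_left

omit [NumberField F] in
/-- `K ∩ K_{U,f}(n) ≤ K_{U,f}(n)`. [folklore] -/
theorem deepenPair_le_finCongruenceLevel (K : Subgroup (finAdelic F E c N J)) (n : ℕ) :
    deepenPair F E c N J K n ≤ finCongruenceLevel F E c N J (Ideal.span {(n : 𝓞 E)}) :=
  inf_le_right

omit [NumberField F] in
/-- `n𝓞_E ≠ 0` for `n ≠ 0`. [folklore] -/
private theorem span_natCast_ne_zero {n : ℕ} (hn : n ≠ 0) : (Ideal.span {(n : 𝓞 E)} : Ideal (𝓞 E)) ≠ 0 := by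
  rw [Ne, Ideal.zero_eq_bot, Ideal.span_singleton_eq_bot]
  exact_mod_cast hn

omit [NumberField F] in
/-- `K ∩ K_{U,f}(n)` is open when `K` is and `n ≠ 0`. [folklore] -/
theorem isOpen_deepenPair {K : Subgroup (finAdelic F E c N J)} (hK : IsOpen (K : Set (finAdelic F E c N J)))
    {n : ℕ} (hn : n ≠ 0) : IsOpen (deepenPair F E c N J K n : Set (finAdelic F E c N J)) := by
  rw [deepenPair, Subgroup.coe_inf]
  exact hK.inter (isOpen_finCongruenceLevel F E c N J (span_natCast_ne_zero hn))

omit [NumberField F] in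
/-- `K ∩ K_{U,f}(n)` is compact when `K` is compact open and `n ≠ 0`. [folklore] -/
theorem isCompact_deepenPair {K : Subgroup (finAdelic F E c N J)} (hKc : IsCompact (K : Set (finAdelic F E c N J)))
    (hK : IsOpen (K : Set (finAdelic F E c N J))) {n : ℕ} (hn : n ≠ 0) :
    IsCompact (deepenPair F E c N J K n : Set (finAdelic F E c N J)) :=
  Subgroup.isCompact_inf_of_isOpen hKc hK (isOpen_finCongruenceLevel F E c N J (span_natCast_ne_zero hn))

omit [NumberField F] in
/-- **`Γ(K ∩ K_{U,f}(n)) = Γ(K) ∩ Γ(n)`** for `n ≠ 0`. [folklore] -/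
theorem arithmeticLevel_deepenPair (K : Subgroup (finAdelic F E c N J)) {n : ℕ} (hn : n ≠ 0) :
    arithmeticLevel F E c N J (deepenPair F E c N J K n) =
      arithmeticLevel F E c N J K ⊓
        Literature.AlgebraicGeometry.ShimuraVarieties.principalCongruenceSubgroup (c : E →+* E) J n := by
  rw [deepenPair, arithmeticLevel_inf, arithmeticLevel_finCongruenceLevel_span hn]

omit [NumberField F] in
/-- **`Γ(K ∩ K_{U,f}(n))` is torsion-free for `3 ≤ n`** (Minkowski). [cite: Minkowski1887, §1] -/
theorem torsionFree_arithmeticLevel_deepenPair (K : Subgroup (finAdelic F E c N J)) {n : ℕ} (hn : 3 ≤ n) :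
    ∀ γ ∈ arithmeticLevel F E c N J (deepenPair F E c N J K n), IsOfFinOrder γ → γ = 1 :=
  torsionFree_arithmeticLevel hn (deepenPair_le_finCongruenceLevel K n)

omit [NumberField F] in
/-- `Γ(K ∩ K_{U,f}(n))` is a congruence subgroup when `K` is compact open and `n ≠ 0`. [folklore] -/
theorem isCongruenceSubgroup_arithmeticLevel_deepenPair {K : Subgroup (finAdelic F E c N J)}
    (hKc : IsCompact (K : Set (finAdelic F E c N J))) (hK : IsOpen (K : Set (finAdelic F E c N J)))
    {n : ℕ} (hn : n ≠ 0) :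
    Literature.AlgebraicGeometry.ShimuraVarieties.IsCongruenceSubgroup (c : E →+* E) J
      (arithmeticLevel F E c N J (deepenPair F E c N J K n)) :=
  isCongruenceSubgroup_arithmeticLevel_of_isOpen (isCompact_deepenPair hKc hK hn) (isOpen_deepenPair hK hn)

end UnitaryGroup

end Literature.NumberTheory.Automorphic
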